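import Summits.ResolutionOfSingularities.ResolutionOfSingularities.Theorems.EquisingularLiftCampaignW45bULT
import Summits.ResolutionOfSingularities.ResolutionOfSingularities.Theorems.EquisingularLiftCampaignW45bULTIdempotentBlowup
import Summits.ResolutionOfSingularities.ResolutionOfSingularities.Theorems.EquisingularLiftCampaignW45bULTSpecialFibreWitnessRing
import Literature.AlgebraicGeometry.Resolution.AffineBlowupUnique
import Literature.AlgebraicGeometry.Motives.VarietiesProjectiveSpaceProofs
import HarnessLib

/-!
# [OURS · L1 W4.5(b)] NEGATIVE SIDE of `EquisingularLift.SpecialFibreReduciblePersists` AS TYPED: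
# `¬ SpecialFibreReduciblePersists n` for every `n` (kernel witness: a non-Noetherian blow-up that is an open immersion)

Cell res-hironaka (LADDER-RESOLUTION rung L, D-0089), slot W4.5(b), crux EL♮ `EquisingularLiftNat`
(stmt-ResolutionOfSingularities-20038); `--supports … --as helper` (negative lane). Prover res-type-100 (gen 9): FINDING
2026-08-27T05:32:49Z, custody res-plan-2 RATIFIES 05:33:15Z «(1⁻) NEGATIVE side ¬ SpecialFibreReduciblePersists n as typed
:= res-type-100». The typed Prop (res-L1-type-o1, `…CampaignW45bULT.lean` §4, p499585; KEPT with an erratum docstring in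
v2 p501162) quantifies over ALL integral `X′ → ℙⁿ_O` and ALL blow-ups `τ : X″ → X′` with NO finiteness; res-D-pv-002 found
it UNPROVABLE-AS-TYPED by hand (05:23:58Z, witness `V[y,z]/(yz − t)` over a non-discrete valuation ring, file
`D/res-D-pv-002/LemmaV-nonNoetherian-witness.md`) and the REPAIRED sibling `SpecialFibreReduciblePersistsLN` (one more
binder `IsLocallyNoetherian X′`) is typed (o1, p501162) and PROVED (res-D-pv-002, p501999
`specialFibreReduciblePersistsLN_holds`). This file closes the record on the as-typed decl with a KERNEL refutation by a
different, lighter witness (no `Proj` of a Rees algebra is needed):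

MECHANISM (`…ULTIdempotentBlowup.lean`, general schemes): if every local ideal `I(U)` of an ideal sheaf `I` is IDEMPOTENT, a morphism pulling `I` back
to an effective Cartier divisor pulls it back to the unit ideal (locally `(g) = (g)²` with `g` regular ⇒ `g` a unit; chart
formula `ideal_comap_of_le` of `MarkedIdealsLemmas.lean`) — `comap_eq_top_of_isEffectiveCartier_of_isIdempotentElem` — so
the open immersion `X ∖ Supp I ↪ X` IS a blow-up of `X` along `I` in the universal-property sense (`Resolution.IsBlowup`,
GW I Def. 13.90) — `isBlowup_ι_compl_support_of_isIdempotentElem`. Such a blow-up is not surjective (possible only for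
centres not of finite type).

WITNESS (the ring: `…ULTSpecialFibreWitnessRing.lean`; the scheme: this file). Over any DVR `(O, 𝔪 = (ϖ))`: `A := {f ∈ O[y^ℚ] : coeff_{y^r} f ∈ 𝔪^⌈-r⌉₊ ∀ r}
= O[y^q (q ≥ 0), ϖ y⁻¹]` (`SpecialFibreWitness.ringA`; an integral domain, not Noetherian); `X′ := Spec A`, mapped into the
chart `D₊(x₀) = Spec (O[x]_{x₀})₀ ≅ Spec O[y₁,…,yₙ]` of `ℙⁿ_O` by `yᵢ ↦ 0` (tree `ProjectiveSpace.chartAlgEquiv`, Mathlib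
`Proj.awayι`), so that `X′ → ℙⁿ_O → Spec O` is `Spec` of the structure map (Mathlib `Proj.awayι_toSpecZero`); the special
fibre `V(𝔪A)` is met by `D(ϖy⁻¹)` and by `D(y)` but not by `D(ϖ) = D(ϖy⁻¹ · y)`, hence is NOT irreducible; the centre
`C := (y^q : q > 0)~` is idempotent (`y^q = y^{q/2} · y^{q/2}`) with `Supp C = V(y)`, so `τ : X″ := D(y) ↪ X′` is a blow-up
along `C`, and its special fibre `V(𝔪A) ∩ D(y)` contains the point `P₁ = ker (A → (O/𝔪)[y^ℚ])` and lies in its closure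
(`f ∈ P₁ ⇒ y f ∈ 𝔪A`), hence IS irreducible. Instantiating at `O = ℤ₂` gives `not_specialFibreReduciblePersists n`.

Main declarations: `SpecialFibreWitness.exists_isBlowup_specialFibre_irreducible_of_reducible` (the counterexample over every DVR, in the binder shape of the
typed Prop), `.not_specialFibreReduciblePersists`. Nothing here is a statement of H. Hironaka's manuscript (EL♮ replaces
the role of NOTHING in the manuscript — it is the W4.5(b) door); no `Literature.…` fact about resolution is used beyond the
tree's blow-up / projective-space libraries. AI-written; AI review is weaker than expert review. [Hironaka2017] — scope only.
References: Görtz–Wedhorn I Def. 13.90 / Prop. 13.91 [GortzWedhorn2020]; Stacks 01OF, 02OS [StacksProject]; tree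
`IsBlowup.isIso_compl`, `ideal_comap_of_le`, `affineBlowup.support_idealSheaf`, `ProjectiveSpace.chartAlgEquiv`,
`ProjBaseChange.algebraBase`.
-/

noncomputable section

set_option linter.dupNamespace false -- mandated namespace of this single-conjunct summit

open CategoryTheory AlgebraicGeometry TopologicalSpace Topology
open Literature.AlgebraicGeometry.Resolution
open AddMonoidAlgebra HomogeneousLocalization

namespace Summit.ResolutionOfSingularities.ResolutionOfSingularities.Theorems

namespace EquisingularLift

namespace SpecialFibreWitness

/-! ## §2 The scheme `X′ = Spec A → ℙⁿ_O`, the idempotent centre, the two special fibres -/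


section Assembly

variable (O : Type) [CommRing O] [IsDomain O] [IsDiscreteValuationRing O] (n : ℕ)

/-- Points of `Spec A` over the closed point of `Spec O` are the primes containing `𝔪A`. [folklore] -/
theorem comap_eq_closedPoint_iff {A : Type*} [CommRing A] [Algebra O A] (x : PrimeSpectrum A) :
    PrimeSpectrum.comap (algebraMap O A) x = IsLocalRing.closedPoint O ↔
      (IsLocalRing.maximalIdeal O).map (algebraMap O A) ≤ x.asIdeal := by
  rw [PrimeSpectrum.ext_iff, PrimeSpectrum.comap_asIdeal, Ideal.map_le_iff_le_comap]
  change _ = IsLocalRing.maximalIdeal O ↔ _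
  constructor
  · intro h; rw [h]
  · intro h
    exact ((IsLocalRing.maximalIdeal.isMaximal O).eq_of_le Ideal.IsPrime.ne_top' h).symm

/-- A set containing a point `ξ` and contained in its closure is preirreducible. [folklore] -/
theorem isPreirreducible_of_subset_closure_singleton {X : Type*} [TopologicalSpace X] {S : Set X} {ξ : X}
    (hξ : ξ ∈ S) (hS : S ⊆ closure {ξ}) : IsPreirreducible S := by
  intro u v hu hv ⟨a, haS, hau⟩ ⟨b, hbS, hbv⟩
  obtain ⟨a', ha'u, ha'⟩ := mem_closure_iff.mp (hS haS) u hu hau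
  obtain ⟨b', hb'v, hb'⟩ := mem_closure_iff.mp (hS hbS) v hv hbv
  rw [Set.mem_singleton_iff] at ha' hb'
  rw [ha'] at ha'u
  rw [hb'] at hb'v
  exact ⟨ξ, hξ, ha'u, hb'v⟩

/-- **The counterexample.** Over every DVR `O` and for every `n` there are an integral `X′ = Spec A → ℙⁿ_O` with
REDUCIBLE special fibre and a blow-up `τ : X″ → X′` (along the idempotent ideal sheaf `(y^q : q > 0)~`, so `τ` is the
open immersion `D(y) ↪ Spec A`) whose special fibre is IRREDUCIBLE. [folklore] -/
theorem exists_isBlowup_specialFibre_irreducible_of_reducible :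
    letI := MvPolynomial.gradedAlgebra (σ := Fin (n + 1)) (R := O)
    ∃ (X' X'' : AlgebraicGeometry.Scheme.{0})
      (σ' : X' ⟶ (AlgebraicGeometry.Proj (MvPolynomial.homogeneousSubmodule (Fin (n + 1)) O)))
      (C : X'.IdealSheafData) (τ : X'' ⟶ X'), AlgebraicGeometry.IsIntegral X' ∧
      Literature.AlgebraicGeometry.Resolution.IsBlowup τ C ∧
      ¬ IsIrreducible ((CategoryTheory.CategoryStruct.comp σ' (CategoryTheory.CategoryStruct.comp
        (AlgebraicGeometry.Proj.toSpecZero (MvPolynomial.homogeneousSubmodule (Fin (n + 1)) O))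
        (AlgebraicGeometry.Spec.map (CommRingCat.ofHom (algebraMap O
          (MvPolynomial.homogeneousSubmodule (Fin (n + 1)) O 0)))))) ⁻¹' {IsLocalRing.closedPoint O}) ∧
      IsIrreducible ((CategoryTheory.CategoryStruct.comp (CategoryTheory.CategoryStruct.comp τ σ')
        (CategoryTheory.CategoryStruct.comp
        (AlgebraicGeometry.Proj.toSpecZero (MvPolynomial.homogeneousSubmodule (Fin (n + 1)) O))
        (AlgebraicGeometry.Spec.map (CommRingCat.ofHom (algebraMap O
          (MvPolynomial.homogeneousSubmodule (Fin (n + 1)) O 0)))))) ⁻¹' {IsLocalRing.closedPoint O}) := by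
  letI := MvPolynomial.gradedAlgebra (σ := Fin (n + 1)) (R := O)
  -- the `O`-algebra structure `O → O[x]₀ → (O[x]_{x₀})₀` (tree `ProjBaseChange.algebraBase`, a non-instance def)
  letI : Algebra O (Away (MvPolynomial.homogeneousSubmodule (Fin (n + 1)) O) (MvPolynomial.X 0)) :=
    Literature.AlgebraicGeometry.Motives.ProjBaseChange.algebraBase _ _
  classical
  obtain ⟨ϖ, hϖ⟩ := IsDiscreteValuationRing.exists_irreducible O
  have hϖmem : ϖ ∈ IsLocalRing.maximalIdeal O := hϖ.maximalIdeal_eq ▸ Ideal.mem_span_singleton_self ϖ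
  -- the ring, its scheme, the centre
  let A := ringA (IsLocalRing.maximalIdeal O)
  let X' : Scheme.{0} := Spec (.of A)
  let C : X'.IdealSheafData := affineBlowup.idealSheaf (idealI (IsLocalRing.maximalIdeal O))
  let U : X'.Opens := ⟨(C.support : Set X')ᶜ, C.support.isClosed.isOpen_compl⟩
  -- the chart map `ℙⁿ_O ⊇ D₊(x₀) = Spec (O[x]_{x₀})₀ ← Spec A`, killing the `xᵢ/x₀`
  let ψ : Away (MvPolynomial.homogeneousSubmodule (Fin (n + 1)) O) (MvPolynomial.X 0) →ₐ[O] A :=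
    (MvPolynomial.aeval fun _ => (0 : A)).comp
      (Literature.AlgebraicGeometry.Motives.ProjectiveSpace.chartAlgEquiv O (0 : Fin (n + 1))).toAlgHom
  let σ' : X' ⟶ Proj (MvPolynomial.homogeneousSubmodule (Fin (n + 1)) O) :=
    Spec.map (CommRingCat.ofHom ψ.toRingHom) ≫
      Proj.awayι (MvPolynomial.homogeneousSubmodule (Fin (n + 1)) O) (MvPolynomial.X 0)
        (Literature.AlgebraicGeometry.Motives.ProjectiveSpace.X_mem 0) zero_lt_one
  have hcomp : σ' ≫ (Proj.toSpecZero (MvPolynomial.homogeneousSubmodule (Fin (n + 1)) O) ≫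
      Spec.map (CommRingCat.ofHom (algebraMap O (MvPolynomial.homogeneousSubmodule (Fin (n + 1)) O 0)))) =
      Spec.map (CommRingCat.ofHom (algebraMap O A)) := by
    simp only [σ', Category.assoc]
    rw [Proj.awayι_toSpecZero_assoc, ← Spec.map_comp, ← Spec.map_comp, ← CommRingCat.ofHom_comp,
      ← CommRingCat.ofHom_comp]
    congr 2
    refine RingHom.ext fun c => ?_
    exact ψ.commutes c
  -- the special fibre of `X'`
  have hF' : ((σ' ≫ (Proj.toSpecZero (MvPolynomial.homogeneousSubmodule (Fin (n + 1)) O) ≫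
      Spec.map (CommRingCat.ofHom (algebraMap O (MvPolynomial.homogeneousSubmodule (Fin (n + 1)) O 0))))) ⁻¹'
        {IsLocalRing.closedPoint O} : Set X') =
      {x : X' | (IsLocalRing.maximalIdeal O).map (algebraMap O A) ≤ x.asIdeal} := by
    rw [hcomp]
    ext x
    change PrimeSpectrum.comap (algebraMap O A) x = IsLocalRing.closedPoint O ↔
      (IsLocalRing.maximalIdeal O).map (algebraMap O A) ≤ x.asIdeal
    exact comap_eq_closedPoint_iff O x
  -- the support of the centre is `V(y)`
  have hsupp : ∀ x : X', x ∈ (C.support : Set X') ↔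
      yPow (IsLocalRing.maximalIdeal O) 1 zero_le_one ∈ x.asIdeal := by
    intro x
    rw [affineBlowup.support_idealSheaf]
    change ((idealI (IsLocalRing.maximalIdeal O) : Ideal A) : Set A) ⊆ (x.asIdeal : Set A) ↔ _
    rw [SetLike.coe_subset_coe, idealI_le_iff _ x.2]
  -- idempotence of the centre and the blow-up
  have hCidem : ∀ V : X'.affineOpens, IsIdempotentElem (C.ideal V) := by
    intro V
    change IsIdempotentElem ((Scheme.IdealSheafData.ofIdealTop
      ((idealI (IsLocalRing.maximalIdeal O)).map (Scheme.ΓSpecIso (.of A)).inv.hom)).ideal V)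
    rw [Scheme.IdealSheafData.ofIdealTop_ideal]
    change Ideal.map _ (Ideal.map _ _) * Ideal.map _ (Ideal.map _ _) = Ideal.map _ (Ideal.map _ _)
    rw [← Ideal.map_mul, ← Ideal.map_mul, (isIdempotentElem_idealI (IsLocalRing.maximalIdeal O)).eq]
  have hτ : IsBlowup U.ι C := isBlowup_ι_compl_support_of_isIdempotentElem hCidem
  refine ⟨X', U, σ', C, U.ι, inferInstance, hτ, ?_, ?_⟩
  · -- the special fibre of `X'` is reducible
    rw [hF']
    intro hirr
    let a : A := xElt (IsLocalRing.maximalIdeal O) ϖ hϖmem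
    let y : A := yPow (IsLocalRing.maximalIdeal O) 1 zero_le_one
    -- both basic opens `D(a)`, `D(y)` meet the special fibre
    have hne : ∀ b : A, (∀ m : ℕ, b ^ m ∉ (IsLocalRing.maximalIdeal O).map (algebraMap O A)) →
        ({x : X' | (IsLocalRing.maximalIdeal O).map (algebraMap O A) ≤ x.asIdeal} ∩
          (PrimeSpectrum.basicOpen b : Set (PrimeSpectrum A))).Nonempty := by
      intro b hb
      by_contra hemp
      rw [Set.not_nonempty_iff_eq_empty] at hemp
      have hrad : b ∈ ((IsLocalRing.maximalIdeal O).map (algebraMap O A)).radical := by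
        rw [← PrimeSpectrum.vanishingIdeal_zeroLocus_eq_radical, PrimeSpectrum.mem_vanishingIdeal]
        intro x hx
        by_contra hbx
        have : x ∈ ({x : X' | (IsLocalRing.maximalIdeal O).map (algebraMap O A) ≤ x.asIdeal} ∩
            (PrimeSpectrum.basicOpen b : Set (PrimeSpectrum A))) :=
          ⟨(PrimeSpectrum.mem_zeroLocus _ _).mp hx, hbx⟩
        rw [hemp] at this
        exact this
      obtain ⟨m, hm⟩ := hrad
      exact hb m hm
    obtain ⟨x, hxF, hxa, hxy⟩ := hirr.isPreirreducible _ _ (PrimeSpectrum.basicOpen a).2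
      (PrimeSpectrum.basicOpen y).2 (hne a (xElt_pow_notMem_map hϖ)) (hne y (yPow_one_pow_notMem_map))
    have hay : a * y ∈ x.asIdeal := hxF (xElt_mul_yPow_one_mem_map hϖ)
    rcases x.2.mem_or_mem hay with h | h
    · exact hxa h
    · exact hxy h
  · -- the special fibre of `X'' = D(y)` is irreducible, with generic point `P₁`
    let P₁ : X' := ⟨primeP (IsLocalRing.maximalIdeal O), isPrime_primeP _⟩
    have hP₁F : (IsLocalRing.maximalIdeal O).map (algebraMap O A) ≤ P₁.asIdeal := map_le_primeP _
    have hP₁U : P₁ ∈ (U : Set X') := by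
      change P₁ ∉ (C.support : Set X')
      rw [hsupp]
      exact yPow_one_notMem_primeP _ (IsLocalRing.maximalIdeal.isMaximal O).ne_top
    -- the set `S = F' ∩ D(y)` downstairs
    let S : Set X' := {x : X' | (IsLocalRing.maximalIdeal O).map (algebraMap O A) ≤ x.asIdeal} ∩
      Set.range U.ι
    have hP₁S : P₁ ∈ S := ⟨hP₁F, by rw [Scheme.Opens.range_ι]; exact hP₁U⟩
    have hSsub : S ⊆ closure {P₁} := by
      rintro x ⟨hxF, hxU⟩
      rw [Scheme.Opens.range_ι] at hxU
      change x ∉ (C.support : Set X') at hxU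
      rw [hsupp] at hxU
      have hle : primeP (IsLocalRing.maximalIdeal O) ≤ x.asIdeal := by
        intro f hf
        rcases x.2.mem_or_mem (hxF (yPow_one_mul_mem_map_of_mem_primeP _ hf)) with h | h
        · exact absurd h hxU
        · exact h
      have hsp : (⟨primeP _, isPrime_primeP _⟩ : PrimeSpectrum A) ⤳ (x : PrimeSpectrum A) :=
        (PrimeSpectrum.le_iff_specializes _ _).mp ((PrimeSpectrum.asIdeal_le_asIdeal _ _).mp hle)
      exact specializes_iff_mem_closure.mp hsp
    have hSirr : IsPreirreducible S := isPreirreducible_of_subset_closure_singleton hP₁S hSsub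
    have heq : (((U.ι ≫ σ') ≫ (Proj.toSpecZero (MvPolynomial.homogeneousSubmodule (Fin (n + 1)) O) ≫
        Spec.map (CommRingCat.ofHom (algebraMap O (MvPolynomial.homogeneousSubmodule (Fin (n + 1)) O 0)))))
          ⁻¹' {IsLocalRing.closedPoint O} : Set U) = U.ι ⁻¹' S := by
      change _ = U.ι ⁻¹' ({x : X' | (IsLocalRing.maximalIdeal O).map (algebraMap O A) ≤ x.asIdeal} ∩
        Set.range U.ι)
      rw [Set.preimage_inter_range, ← hF']
      ext u
      simp only [Set.mem_preimage, Scheme.Hom.comp_apply]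
    rw [heq]
    refine ⟨?_, hSirr.preimage U.ι.isOpenEmbedding⟩
    have hP₁r : P₁ ∈ Set.range U.ι := by rw [Scheme.Opens.range_ι]; exact hP₁U
    obtain ⟨u, hu⟩ := hP₁r
    exact ⟨u, by rw [Set.mem_preimage, hu]; exact hP₁S⟩

end Assembly

/-- [OURS · L1 W4.5(b)] replaces the role of NOTHING in the manuscript; NOT a statement of the manuscript. **NEGATIVE SIDE:
`SpecialFibreReduciblePersists n` AS TYPED (res-L1-type-o1 p499585 §4, kept with erratum in v2 p501162) is REFUTED for
every `n`** — instantiate `exists_isBlowup_specialFibre_irreducible_of_reducible` at the DVR `ℤ₂` (any DVR works). The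
missing hypothesis is finiteness of `X′`: with `IsLocallyNoetherian X′` the statement is the sibling
`SpecialFibreReduciblePersistsLN`, PROVED by res-D-pv-002 (`specialFibreReduciblePersistsLN_holds`, p501999). Custody
res-plan-2 2026-08-27T05:33:15Z «(1⁻) negative side := res-type-100». [folklore] -/
theorem not_specialFibreReduciblePersists (n : ℕ) : ¬ SpecialFibreReduciblePersists n := by
  intro h
  obtain ⟨X', X'', σ', C, τ, hint, hτ, hF', hF''⟩ :=
    exists_isBlowup_specialFibre_irreducible_of_reducible ℤ_[2] n
  exact h ℤ_[2] X' X'' σ' C τ hint hτ hF' hF''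

end SpecialFibreWitness

end EquisingularLift

end Summit.ResolutionOfSingularities.ResolutionOfSingularities.Theorems

end
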